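import Summits.HodgeConjecture.HodgeConjecture.Theorems.LimitExtensionSpecialisationOfAlgebraicityOfSpread
import Literature.AlgebraicGeometry.Motives.SmoothProjectiveFamilyOverOpen

/-!
# Route LimitExtension — crux `LimitExtensionMid` (stmt-HodgeConjecture-2995), line `birth`: a flat proper degeneration is a smooth projective family near every smooth projective fibre

Infrastructure for the registered stub `stub_fixedPartOnPuncturedCurve` of the skeleton
`Cruxes/LimitExtensionMid/Lines/birth.lean` (the theorem of the fixed part on the punctured curve of a
hypersurface degeneration, from the named fact `charlesSchnell_hodgeClass_of_flat`). The named fact is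
stated for SMOOTH PROJECTIVE FAMILIES (`Motives.IsSmoothProjectiveFamily f n`: smooth of relative
dimension `n`, proper, smooth projective fibres) over smooth connected quasi-projective bases, whereas
the crux carries a FLAT PROPER degeneration `f : W ⟶ T` whose fibres off `t₀` are smooth
hypersurfaces. This file supplies the bridge, with no Hodge theory:

* `smoothOfRelativeDimension_morphismRestrict_of_preimage_le` — if `𝒱 ↪ W ⟶ T` is smooth of relative
  dimension `m` on an open `𝒱 ⊆ W` containing `f⁻¹ V`, then `f⁻¹ V ⟶ V` is smooth of relative
  dimension `m`.
* `smoothOfRelativeDimension_iSup_ι_comp` — smoothness of relative dimension `m` on each member of a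
  family of opens gives it on their union (Zariski-local on the source).
* `exists_smoothOfRelativeDimension_morphismRestrict_of_forall_fibre` — for `f` universally closed:
  if every point over `y` has an open neighbourhood on which `f` is smooth of relative dimension
  `m`, then `f⁻¹ V' ⟶ V'` is smooth of relative dimension `m` for all opens `V'` inside some open
  `V ∋ y` (`V = T ∖ f(W ∖ 𝒱)`).
* `exists_smoothOfRelativeDimension_nhd_of_isSmoothProjective_fiberOver` — **fibre criterion with the
  relative dimension read off the fibre**: for `f : W ⟶ T` flat and proper over a `ℂ`-scheme locally
  of finite type and `t ∈ T(ℂ)` with `W_t` smooth projective of dimension `m`, every point over `t`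
  has an open neighbourhood on which `f` is smooth of relative dimension EXACTLY `m` (EGA IV₄ 17.5.1
  via the tree's `mem_smoothLocus_of_isOpenImmersion_fiberOver`; the relative dimension of a chart is
  that of its base change to the fibre, an open piece of the smooth `m`-fold `W_t`, by uniqueness of
  the relative dimension `Motives.AbelianVarietyProofs.eq_of_smoothOfRelativeDimension`).
* `exists_isAffineOpen_smoothOfRelativeDimension_morphismRestrict` — hence an AFFINE open `V ∋ pt t`
  inside any prescribed open neighbourhood with `f⁻¹ V ⟶ V` smooth of relative dimension `m`; and
  `exists_isAffineOpen_isSmoothProjectiveFamily` — if moreover all complex fibres over the prescribed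
  open are smooth projective `m`-folds, the restricted family over `V` is an
  `IsSmoothProjectiveFamily` (`Motives.SectionFamily.isSmoothProjectiveFamily_snd_openSubschemeOverι`).

No definition, no named fact, no `sorry`; `HC_CM` plays no role here.

References: [EGAIV4] A. Grothendieck, EGA IV₄ (1967), Thm. 17.5.1; [StacksProject] Tag 01V8;
[GortzWedhorn2020] U. Görtz, T. Wedhorn, Algebraic Geometry I, Prop. 6.15, Lemma 6.26.
-/

noncomputable section

-- mandated namespace of this single-conjunct summit; see the sibling `LimitExtension*` files
set_option linter.dupNamespace false

open CategoryTheory CategoryTheory.Limits AlgebraicGeometry TopologicalSpace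
open Literature.AlgebraicGeometry.Motives Literature.AlgebraicGeometry.HodgeTheory

namespace Summit.HodgeConjecture.HodgeConjecture.Theorems

/-! ### Smoothness of a fixed relative dimension: from an open of the source to a neighbourhood of a fibre -/

section SchemeLevel

variable {X Y : Scheme} (f : X ⟶ Y) (m : ℕ)

/-- If `𝒱 ↪ X ⟶ Y` is smooth of relative dimension `m` for an open `𝒱 ⊆ X` containing `f⁻¹ V`,
then the restriction `f⁻¹ V ⟶ V` is smooth of relative dimension `m`: restrict `𝒱 ⟶ Y` over `V`
(Zariski-local on the target) and note that `𝒱 ∩ f⁻¹ V ⟶ f⁻¹ V` is a surjective open immersion,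
i.e. an isomorphism. [cite: GortzWedhorn2020, Prop. 6.15] -/
theorem smoothOfRelativeDimension_morphismRestrict_of_preimage_le (𝒱 : X.Opens)
    (h𝒱 : SmoothOfRelativeDimension m (𝒱.ι ≫ f)) (V : Y.Opens) (hV : f ⁻¹ᵁ V ≤ 𝒱) :
    SmoothOfRelativeDimension m (f ∣_ V) := by
  have h1 : SmoothOfRelativeDimension m (𝒱.ι ∣_ f ⁻¹ᵁ V ≫ f ∣_ V) := by
    have h := IsZariskiLocalAtTarget.restrict h𝒱 V
    rw [morphismRestrict_comp] at h
    exact h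
  haveI : IsIso (𝒱.ι ∣_ f ⁻¹ᵁ V) := by
    rw [isIso_iff_isOpenImmersion_and_surjective]
    refine ⟨inferInstance, ⟨fun x => ?_⟩⟩
    refine ⟨⟨⟨x.1, hV x.2⟩, show (𝒱.ι ⟨x.1, hV x.2⟩) ∈ f ⁻¹ᵁ V from x.2⟩, ?_⟩
    apply Subtype.ext
    rw [morphismRestrict_base_coe]
    rfl
  rwa [MorphismProperty.cancel_left_of_respectsIso (@SmoothOfRelativeDimension m)] at h1

/-- Smoothness of relative dimension `m` on every member `U i ↪ X ⟶ Y` of a family of opens gives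
it on the union `(⨆ i, U i) ↪ X ⟶ Y` (the property is Zariski-local on the source; cover of
`⨆ i, U i` by the `U i`, Mathlib `Scheme.Opens.iSupOpenCover`). [cite: GortzWedhorn2020, Prop. 6.15] -/
theorem smoothOfRelativeDimension_iSup_ι_comp {ι : Type*} (U : ι → X.Opens)
    (hU : ∀ i, SmoothOfRelativeDimension m ((U i).ι ≫ f)) :
    SmoothOfRelativeDimension m ((⨆ i, U i).ι ≫ f) := by
  refine IsZariskiLocalAtSource.of_openCover (Scheme.Opens.iSupOpenCover U) fun i => ?_
  change SmoothOfRelativeDimension m (X.homOfLE (le_iSup U i) ≫ (⨆ i, U i).ι ≫ f)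
  rw [Scheme.homOfLE_ι_assoc]
  exact hU i

/-- **From charts along a fibre to a neighbourhood of the fibre.** Let `f : X ⟶ Y` be universally
closed and `y ∈ Y` such that every point of `X` over `y` has an open neighbourhood `U` with
`U ↪ X ⟶ Y` smooth of relative dimension `m`. Then there is an open `V ∋ y` such that
`f⁻¹ V' ⟶ V'` is smooth of relative dimension `m` for every open `V' ⊆ V`: take `𝒱` the union of the
charts and `V = Y ∖ f(X ∖ 𝒱)`, open because `f` is closed. [cite: EGAIV4, Thm. 17.5.1] -/
theorem exists_smoothOfRelativeDimension_morphismRestrict_of_forall_fibre [UniversallyClosed f]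
    (y : Y) (h : ∀ x : X, f x = y → ∃ U : X.Opens, x ∈ U ∧ SmoothOfRelativeDimension m (U.ι ≫ f)) :
    ∃ V : Y.Opens, y ∈ V ∧ ∀ V' : Y.Opens, V' ≤ V → SmoothOfRelativeDimension m (f ∣_ V') := by
  choose U hxU hU using h
  set 𝒱 : X.Opens := ⨆ x : {x : X // f x = y}, U x.1 x.2 with h𝒱
  have h𝒱sm : SmoothOfRelativeDimension m (𝒱.ι ≫ f) :=
    smoothOfRelativeDimension_iSup_ι_comp f m _ fun x => hU x.1 x.2
  have hcl : IsClosed (f '' (𝒱 : Set X)ᶜ) := f.isClosedMap _ 𝒱.isOpen.isClosed_compl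
  refine ⟨⟨(f '' (𝒱 : Set X)ᶜ)ᶜ, hcl.isOpen_compl⟩, ?_, fun V' hV' => ?_⟩
  · rintro ⟨x, hx, hxy⟩
    exact hx (Opens.mem_iSup.mpr ⟨⟨x, hxy⟩, hxU x hxy⟩)
  · refine smoothOfRelativeDimension_morphismRestrict_of_preimage_le f m 𝒱 h𝒱sm V' fun x hx => ?_
    by_contra hx𝒱
    exact hV' hx ⟨x, hx𝒱, rfl⟩

end SchemeLevel

/-! ### The relative dimension at a smooth projective fibre -/

section Fibre

variable {W T : SchemeOver ℂ} (f : W ⟶ T)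

/-- The underlying map of a complex point `t : Spec ℂ ⟶ T` has range `{pt t}`. [folklore] -/
theorem range_complexPoint_left_base (t : ComplexPoints T) :
    Set.range t.left.base = {t.pt} := by
  haveI : Unique ↥(specOver ℂ ℂ).left := inferInstanceAs (Unique (PrimeSpectrum ℂ))
  rw [Set.range_eq_singleton]
  exact fun x => congr(t.left.base $(Subsingleton.elim x _))

/-- A point of `W` over `pt t` is the image of a point of the scheme-theoretic fibre `W_t = W ×_T Spec ℂ`
(Mathlib `Scheme.Pullback.range_fst`). [folklore] -/
theorem exists_fiberι_base_eq_of_apply_eq (t : ComplexPoints T) {x : W.left}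
    (hx : f.left x = t.pt) : ∃ z : ↥(fiberOver f t).left, (fiberι f t).left z = x := by
  have hmem : x ∈ Set.range (pullback.fst f.left t.left) := by
    rw [Scheme.Pullback.range_fst, Set.mem_preimage, range_complexPoint_left_base]
    exact hx
  obtain ⟨z, hz⟩ := hmem
  exact ⟨z, hz⟩

/-- The second projection `W_t = W ×_T Spec ℂ ⟶ Spec ℂ` IS the structure morphism of the `ℂ`-scheme
`fiberOver f t` (the structure map of `Spec ℂ` over `ℂ` being the identity). [folklore] -/
theorem fiberOver_hom_eq_snd (t : ComplexPoints T) :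
    (fiberOver f t).hom = pullback.snd f.left t.left := by
  rw [fiberOver_hom]
  change pullback.snd f.left t.left ≫ Spec.map (CommRingCat.ofHom (algebraMap ℂ ℂ)) = _
  rw [Algebra.algebraMap_self, CommRingCat.ofHom_id, Spec.map_id]
  exact Category.comp_id _

/-- **The relative dimension of a chart through a smooth projective fibre is the dimension of the
fibre.** If `U ↪ W ⟶ T` is smooth of relative dimension `N` on an open `U` meeting the fibre over
`t ∈ T(ℂ)`, and `W_t` is a smooth projective `m`-fold, then `N = m`: base-change the chart to the
fibre — an open piece of `W_t`, smooth over `ℂ` of relative dimension both `N` and `m`.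
[cite: GortzWedhorn2020, Lemma 6.26] -/
theorem eq_of_smoothOfRelativeDimension_ι_comp_of_isSmoothProjective_fiberOver {m N : ℕ}
    (t : ComplexPoints T) (ht : IsSmoothProjective m (fiberOver f t)) (U : W.left.Opens)
    (hU : SmoothOfRelativeDimension N (U.ι ≫ f.left)) {x : W.left} (hxU : x ∈ U)
    (hx : f.left x = t.pt) : N = m := by
  -- notation: the fibre `F ⟶ W` and its open piece `F ∩ U`
  set ιF : (fiberOver f t).left ⟶ W.left := pullback.fst f.left t.left with hιF
  -- the base change of the chart to the fibre is the open `ιF ⁻¹ U` of the fibre over `Spec ℂ`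
  have sq : IsPullback (ιF ∣_ U) ((ιF ⁻¹ᵁ U).ι ≫ pullback.snd f.left t.left) (U.ι ≫ f.left) t.left :=
    (isPullback_morphismRestrict ιF U).paste_vert (IsPullback.of_hasPullback f.left t.left)
  haveI := smoothOfRelativeDimension_isStableUnderBaseChange (n := N)
  have hN : SmoothOfRelativeDimension N ((ιF ⁻¹ᵁ U).ι ≫ pullback.snd f.left t.left) :=
    MorphismProperty.of_isPullback sq hU
  -- the same open piece is smooth of relative dimension `m` over `ℂ`, as an open of `W_t`
  have hm : SmoothOfRelativeDimension m ((ιF ⁻¹ᵁ U).ι ≫ pullback.snd f.left t.left) := by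
    rw [← fiberOver_hom_eq_snd]
    haveI := ht.smoothOfRelativeDimension
    have h : SmoothOfRelativeDimension (0 + m) ((ιF ⁻¹ᵁ U).ι ≫ (fiberOver f t).hom) := inferInstance
    rwa [Nat.zero_add] at h
  -- and it is non-empty: it contains a point over `x`
  obtain ⟨z, hz⟩ := exists_fiberι_base_eq_of_apply_eq f t hx
  haveI : Nonempty ((ιF ⁻¹ᵁ U : (fiberOver f t).left.Opens) : Scheme) := ⟨⟨z, show ιF z ∈ U by
    change (fiberι f t).left z ∈ U
    rw [hz]; exact hxU⟩⟩
  exact AbelianVarietyProofs.eq_of_smoothOfRelativeDimension _ hN hm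

/-- **Fibre criterion with the relative dimension read off the fibre** (EGA IV₄ 17.5.1). Let
`f : W ⟶ T` be flat and proper over a `ℂ`-scheme `T` locally of finite type, and `t ∈ T(ℂ)` with
`W_t` a smooth projective `m`-fold. Then every point of `W` over `pt t` has an open neighbourhood `U`
with `U ↪ W ⟶ T` smooth of relative dimension `m`: the point lies in the smooth locus
(`mem_smoothLocus_of_isOpenImmersion_fiberOver`, applied to the whole smooth fibre), about which `f`
is smooth of SOME relative dimension (`exists_smoothOfRelativeDimension_of_mem_smoothLocus`), which is
`m` by `eq_of_smoothOfRelativeDimension_ι_comp_of_isSmoothProjective_fiberOver`.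
[cite: EGAIV4, Thm. 17.5.1] [cite: StacksProject, Tag 01V8] -/
theorem exists_smoothOfRelativeDimension_nhd_of_isSmoothProjective_fiberOver {m : ℕ}
    [Flat f.left] [IsProper f.left] [LocallyOfFiniteType T.hom] (t : ComplexPoints T)
    (ht : IsSmoothProjective m (fiberOver f t)) (x : W.left) (hx : f.left x = t.pt) :
    ∃ U : W.left.Opens, x ∈ U ∧ SmoothOfRelativeDimension m (U.ι ≫ f.left) := by
  haveI : IsLocallyNoetherian T.left := LocallyOfFiniteType.isLocallyNoetherian T.hom
  haveI : LocallyOfFinitePresentation f.left :=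
    Literature.AlgebraicGeometry.HodgeTheory.locallyOfFinitePresentation_of_isLocallyNoetherian f.left
  haveI : Smooth (fiberOver f t).hom := by
    haveI := ht.smoothOfRelativeDimension
    exact SmoothOfRelativeDimension.smooth m _
  obtain ⟨z, hz⟩ := exists_fiberι_base_eq_of_apply_eq f t hx
  have hxsm : x ∈ f.left.smoothLocus := by
    have h := mem_smoothLocus_of_isOpenImmersion_fiberOver f t (𝟙 (fiberOver f t)) z
    rwa [Category.id_comp, hz] at h
  obtain ⟨U, N, hxU, hU⟩ := exists_smoothOfRelativeDimension_of_mem_smoothLocus f.left hxsm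
  obtain rfl : N = m :=
    eq_of_smoothOfRelativeDimension_ι_comp_of_isSmoothProjective_fiberOver f t ht U hU hxU hx
  exact ⟨U, hxU, hU⟩

/-- **A flat proper family is smooth of relative dimension `m` over an affine neighbourhood of a
smooth projective `m`-dimensional fibre**, the neighbourhood chosen inside any prescribed open
`O ∋ pt t`. [cite: EGAIV4, Thm. 17.5.1] -/
theorem exists_isAffineOpen_smoothOfRelativeDimension_morphismRestrict {m : ℕ}
    [Flat f.left] [IsProper f.left] [LocallyOfFiniteType T.hom] (t : ComplexPoints T)
    (ht : IsSmoothProjective m (fiberOver f t)) (O : T.left.Opens) (htO : t.pt ∈ O) :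
    ∃ V : T.left.Opens, IsAffineOpen V ∧ t.pt ∈ V ∧ V ≤ O ∧
      SmoothOfRelativeDimension m (f.left ∣_ V) := by
  obtain ⟨V₀, htV₀, hV₀⟩ := exists_smoothOfRelativeDimension_morphismRestrict_of_forall_fibre f.left m
    t.pt (exists_smoothOfRelativeDimension_nhd_of_isSmoothProjective_fiberOver f t ht)
  obtain ⟨V, hV, htV, hVle⟩ :=
    exists_isAffineOpen_mem_and_subset (U := V₀ ⊓ O) (x := t.pt) ⟨htV₀, htO⟩
  exact ⟨V, hV, htV, fun y hy => (hVle hy).2, hV₀ V fun y hy => (hVle hy).1⟩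

/-- **Near a good fibre a flat proper degeneration restricts to a smooth projective family.** Let
`f : W ⟶ T` be flat and proper over a `ℂ`-scheme locally of finite type, `O ⊆ T` an open all of whose
complex points have smooth projective `m`-dimensional fibres, and `t ∈ O(ℂ)`. Then there is an affine
open `V`, `pt t ∈ V ⊆ O`, such that the restricted family `W ×_T V ⟶ V` is a smooth projective family
of relative dimension `m` (`Motives.SectionFamily.isSmoothProjectiveFamily_snd_openSubschemeOverι`).
[cite: EGAIV4, Thm. 17.5.1] [cite: VoisinHodgeII2003, §2.1.1] -/
theorem exists_isAffineOpen_isSmoothProjectiveFamily {m : ℕ} [Flat f.left] [IsProper f.left]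
    [LocallyOfFiniteType T.hom] (O : T.left.Opens)
    (hO : ∀ b : ComplexPoints T, b.pt ∈ O → IsSmoothProjective m (fiberOver f b))
    (t : ComplexPoints T) (htO : t.pt ∈ O) :
    ∃ V : T.left.Opens, IsAffineOpen V ∧ t.pt ∈ V ∧ V ≤ O ∧
      IsSmoothProjectiveFamily (familyPullback.snd f (openSubschemeOverι T V)) m := by
  obtain ⟨V, hV, htV, hVO, hsm⟩ :=
    exists_isAffineOpen_smoothOfRelativeDimension_morphismRestrict f t (hO t htO) O htO
  exact ⟨V, hV, htV, hVO, SectionFamily.isSmoothProjectiveFamily_snd_openSubschemeOverι f V hsm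
    fun b hb => hO b (hVO hb)⟩

end Fibre

end Summit.HodgeConjecture.HodgeConjecture.Theorems

end
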